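import Summits.PneNP.PneNP.Theorems.SymmetryBudgetHamCompilesFDagSem

/-!
# The wiring of the F-side gate DAG is natural under budget permutations
# (stub `stub_symmetricF`, obligation `stub_symmetricF_aut`, part 2/3;
# crux `SymmetryBudget.HamCompiles`, stmt-PneNP-10637)

A budget permutation `ρ ∈ Bud m (gOf m)` acts on the gate labels of the F-side DAG
(`SymmetryBudgetHamCompilesFDag.lean`) by relabelling every vertex index (`SymF.fmapB`,
`SymmetryBudgetHamCompilesFDagSem.lean` §4), hence on wires by
`θ̂ = Sum.map (SymA.diag ρ) (fmapB hρ)`. This file proves that every composite wire of the wiring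
commutes with `θ̂`: `θ̂ (uW τ B c c') = uW (tmap τ) (pmap B) c c'`, …, `θ̂ (zW χ k s c') =
zW (cmap χ) k s c'`, and finally that the wiring of every insertion block is relabelled argument by
argument (`bargs_natural`, the registered sub-goal of this file). Part 3
(`SymmetryBudgetHamCompilesFAut.lean`) assembles the automorphism clauses of `SymF.AutProps`.
-/

-- `Summit.PneNP.PneNP.…` duplicates `PneNP` BY DESIGN (single-problem summit, D-0017).
set_option linter.dupNamespace false

noncomputable section

namespace Summit.PneNP.PneNP.Theorems.HamCompilesKC

open Literature.Computability.Complexity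
open Finset

namespace SymF

variable {m : ℕ}

/-! ### Images of subsets of the free part -/

section Action

variable {f : Fin m → Fin m} {hf : Function.Injective f} {hF : ∀ u ∈ freeSet m, f u ∈ freeSet m}

/-- The image of a subset is empty iff the subset is. -/
theorem pmap_eq_empty_iff (P : PSet m) : (pmap f hf hF P).1 = ∅ ↔ P.1 = ∅ :=
  Finset.map_eq_empty

/-- Membership in the image of a subset. -/
theorem mem_pmap_iff (P : PSet m) (t : Fin m) : f t ∈ (pmap f hf hF P).1 ↔ t ∈ P.1 :=
  Finset.mem_map' ⟨f, hf⟩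

/-- Images commute with erasing a vertex. -/
theorem pmap_erase (P : PSet m) (t : Fin m) :
    pmap f hf hF (P.erase t) = (pmap f hf hF P).erase (f t) :=
  Subtype.ext (Finset.map_erase ⟨f, hf⟩ P.1 t)

variable {f' : Fin m → Fin m} {hf' : Function.Injective f'}
  {hF' : ∀ u ∈ freeSet m, f' u ∈ freeSet m}

/-- A left inverse of `f` induces a left inverse on subsets. -/
theorem pmap_pmap (h : ∀ u, f' (f u) = u) (P : PSet m) :
    pmap f' hf' hF' (pmap f hf hF P) = P := by
  apply Subtype.ext
  ext u
  simp only [pmap, Finset.mem_map, Function.Embedding.coeFn_mk]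
  constructor
  · rintro ⟨v, ⟨w, hw, rfl⟩, rfl⟩
    rw [h]
    exact hw
  · intro hu
    exact ⟨f u, ⟨u, hu, rfl⟩, h u⟩

/-- A left inverse of `f` induces a left inverse on tower contexts. -/
theorem tmap_tmap (h : ∀ u, f' (f u) = u) (τ : TCtx m) :
    tmap f' hf' hF' (tmap f hf hF τ) = τ := by
  cases τ <;> simp [tmap, pmap_pmap h, h]

/-- A left inverse of `f` induces a left inverse on chain contexts. -/
theorem cmap_cmap (h : ∀ u, f' (f u) = u) (χ : ChCtx m) :
    cmap f' hf' hF' (cmap f hf hF χ) = χ := by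
  cases χ <;> simp [cmap, tmap_tmap h, pmap_pmap h, h]

/-- A left inverse of `f` induces a left inverse on gate labels. -/
theorem gmap_gmap (h : ∀ u, f' (f u) = u) (g : FG m) :
    gmap f' hf' hF' (gmap f hf hF g) = g := by
  cases g <;> simp [gmap, tmap_tmap h, cmap_cmap h, pmap_pmap h, h]

end Action

/-! ### Naturality of the composite wires under a budget permutation -/

section Budget

variable {ρ : Equiv.Perm (Fin m)} (hρ : ρ ∈ Bud m (gOf m))

set_option hygiene false in
/-- The relabelling of wires by the budget permutation `ρ` (notation). -/
local notation "θ̂" => Sum.map (SymA.diag ρ) (fmapB hρ)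

set_option hygiene false in
/-- The relabelling of subsets of the free part by `ρ` (notation). -/
local notation "pmapρ" => pmap (⇑ρ) (Equiv.injective ρ) (bud_mem_freeSet hρ)

set_option hygiene false in
/-- The relabelling of tower contexts by `ρ` (notation). -/
local notation "tmapρ" => tmap (⇑ρ) (Equiv.injective ρ) (bud_mem_freeSet hρ)

set_option hygiene false in
/-- The relabelling of chain contexts by `ρ` (notation). -/
local notation "cmapρ" => cmap (⇑ρ) (Equiv.injective ρ) (bud_mem_freeSet hρ)

/-- A budget permutation maps the free part onto itself. -/
theorem pmap_top : pmapρ (PSet.top m) = PSet.top m := by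
  apply Subtype.ext
  refine Finset.eq_of_subset_of_card_le (fun u hu => ?_) (Finset.card_map _).ge
  obtain ⟨v, hv, rfl⟩ := Finset.mem_map.1 hu
  exact bud_mem_freeSet hρ v hv

/-- Tower table wires are natural. -/
theorem fmapB_uW (τ : TCtx m) (B : PSet m) (c c' : K m) :
    θ̂ (uW τ B c c') = uW (tmapρ τ) (pmapρ B) c c' := by
  cases τ with
  | ot P t i e =>
    simp only [uW, tmap, apply_ite θ̂]
    exact ite_congr (propext (pmap_eq_empty_iff B).symm) (fun _ => rfl) (fun _ => rfl)
  | ct P e =>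
    simp only [uW, tmap, apply_ite θ̂]
    exact ite_congr (propext (pmap_eq_empty_iff B).symm) (fun _ => rfl) (fun _ => rfl)

/-- Closed-state table wires are natural. -/
theorem fmapB_cTab (P : PSet m) (e : Cd m) (c c' : K m) :
    θ̂ (cTab P e c c') = cTab (pmapρ P) e c c' := by
  unfold cTab
  rw [apply_ite θ̂, fmapB_uW]
  exact ite_congr (propext (pmap_eq_empty_iff P).symm) (fun _ => rfl) (fun _ => rfl)

/-- Open-state table wires are natural. -/
theorem fmapB_oTab (P : PSet m) (t : Fin m) (i : Fin (gOf m)) (e : Cd m) (c c' : K m) :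
    θ̂ (oTab P t i e c c') = oTab (pmapρ P) (ρ t) i e c c' := by
  unfold oTab
  rw [apply_ite θ̂, fmapB_uW, pmap_erase]
  exact ite_congr (propext (mem_pmap_iff P t).symm) (fun _ => rfl) (fun _ => rfl)

/-- Inner accumulator wires are natural. -/
theorem fmapB_accW (P : PSet m) (e : Cd m) (t : Fin m) (r : ℕ) (c c' : K m) :
    θ̂ (accW P e t r c c') = accW (pmapρ P) e (ρ t) r c c' := by
  unfold accW
  split_ifs <;> rfl

/-- Left table wires are natural. -/
theorem fmapB_leftW (χ : ChCtx m) (c c' : K m) :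
    θ̂ (leftW χ c c') = leftW (cmapρ χ) c c' := by
  cases χ with
  | tw τ B w =>
    simp only [leftW, cmap]
    rw [apply_ite θ̂, fmapB_uW, pmap_erase]
    exact ite_congr (propext (mem_pmap_iff B w).symm) (fun _ => rfl) (fun _ => rfl)
  | inner P e t r => exact fmapB_accW hρ P e t r c c'

/-- Table wires are natural. -/
theorem fmapB_tabW (χ : ChCtx m) (k : Fin (N m)) (c c' : K m) :
    θ̂ (tabW χ k c c') = tabW (cmapρ χ) k c c' := by
  unfold tabW
  split_ifs
  · exact fmapB_leftW hρ χ c c'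
  · rfl

/-- Row-source wires are natural. -/
theorem fmapB_rowW (χ : ChCtx m) (k : Fin (N m)) (c' : K m) :
    θ̂ (rowW χ k c') = rowW (cmapρ χ) k c' := by
  cases χ with
  | tw τ B w =>
    cases τ with
    | ot P t i e => rfl
    | ct P e => exact fmapB_accW hρ P e w _ (kc k) c'
  | inner P e t r =>
    simp only [rowW, cmap]
    split_ifs <;> rfl

/-- Remainder wires are natural. -/
theorem fmapB_zW (χ : ChCtx m) (k : Fin (N m)) (s : ℕ) (c' : K m) :
    θ̂ (zW χ k s c') = zW (cmapρ χ) k s c' := by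
  unfold zW
  split_ifs
  · exact fmapB_rowW hρ χ k c'
  · rfl
  · rfl

/-- **The wiring of the insertion blocks is natural** under budget permutations (closed,
ASCII-named: the registered sub-goal of this file): the relabelled `a`-th wire of block gate
`(χ, k, κ)` is the `a`-th wire of the image gate `(cmap χ, k, κ)`. -/
theorem bargs_natural (m : ℕ) (ρ : Equiv.Perm (Fin m)) (hρ : ρ ∈ Bud m (gOf m)) (χ : ChCtx m)
    (k : Fin (N m)) (κ : BK m) (a : Fin (bfn m κ).1) :
    Sum.map (SymA.diag ρ) (fmapB hρ) (bargs χ k κ a) =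
      bargs (cmap (⇑ρ) (Equiv.injective ρ) (bud_mem_freeSet hρ) χ) k κ a := by
  cases κ with
  | ya s c' =>
    refine Fin.cases ?_ (Fin.cases ?_ (fun j => j.elim0)) a
    · exact fmapB_rowW hρ χ k (kc s)
    · exact fmapB_tabW hρ χ k (kc s) c'
  | xo s c' =>
    refine Fin.cases ?_ (Fin.cases ?_ (fun j => j.elim0)) a
    · exact fmapB_zW hρ χ k s c'
    · rfl
  | xa s c' =>
    refine Fin.cases ?_ (Fin.cases ?_ (fun j => j.elim0)) a
    · exact fmapB_zW hρ χ k s c'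
    · rfl
  | xn s c' => exact Fin.cases rfl (fun j => j.elim0) a
  | xr s c' => exact Fin.cases rfl (Fin.cases rfl (fun j => j.elim0)) a
  | nz c =>
    refine Fin.cases ?_ (fun j => j.elim0) a
    exact fmapB_zW hρ χ k (N m) c
  | ld c =>
    refine Fin.cases ?_ (fun s => ?_) a
    · exact fmapB_zW hρ χ k (N m) c
    · show θ̂ (if skey (kc s) < skey c then fW (FG.blk χ k (.nz (kc s))) else oneW) =
        if skey (kc s) < skey c then fW (FG.blk (cmapρ χ) k (.nz (kc s))) else oneW
      split_ifs <;> rfl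
  | al c ℓ =>
    refine Fin.cases rfl (Fin.cases ?_ (fun j => j.elim0)) a
    exact fmapB_tabW hρ χ k c ℓ
  | q c => rfl
  | nl c => exact Fin.cases rfl (fun j => j.elim0) a
  | t1 c c' =>
    refine Fin.cases rfl (Fin.cases ?_ (fun j => j.elim0)) a
    exact fmapB_zW hρ χ k (N m) c'
  | wq c c' =>
    refine Fin.cases ?_ (Fin.cases rfl (fun j => j.elim0)) a
    exact fmapB_zW hρ χ k (N m) c'
  | uo c c' =>
    refine Fin.cases ?_ (Fin.cases rfl (fun j => j.elim0)) a
    exact fmapB_tabW hρ χ k c c'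
  | ua c c' =>
    refine Fin.cases ?_ (Fin.cases rfl (fun j => j.elim0)) a
    exact fmapB_tabW hρ χ k c c'
  | un c c' => exact Fin.cases rfl (fun j => j.elim0) a
  | ux c c' => exact Fin.cases rfl (Fin.cases rfl (fun j => j.elim0)) a
  | t2 c c' => exact Fin.cases rfl (Fin.cases rfl (fun j => j.elim0)) a
  | out c c' => exact Fin.cases rfl (Fin.cases rfl (fun j => j.elim0)) a

end Budget

end SymF

end Summit.PneNP.PneNP.Theorems.HamCompilesKC
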